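import Mathlib.RingTheory.Polynomial.Hermite.Basic
import Mathlib.Algebra.Polynomial.Derivative
import Mathlib.Analysis.Calculus.Deriv.Polynomial
import Mathlib.Probability.Distributions.Gaussian.Real
import Literature.Probability.Distributions.GaussianMoments
import HarnessLib

/-!
# Hermite polynomials and the standard Gaussian: Stein's identity and orthogonality

For the probabilists' Hermite polynomials `Heₙ` (Mathlib's `Polynomial.hermite`, over `ℤ`,
`He_{n+1} = X Heₙ - Heₙ'`) viewed as real polynomials `hermiteR n`, and the standard Gaussian
`γ₁ = gaussianReal 0 1`, we prove

* `derivative_hermite_succ` : `He_{n+1}' = (n + 1) Heₙ` (Appell property);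
* `integral_id_mul_eval_gaussianReal` (**Stein's identity** on polynomials):
  `∫ x p(x) dγ₁ = ∫ p'(x) dγ₁`, from the moment recursion `m_{k+1} = k m_{k-1}`
  (`Literature.Probability.Distributions.integral_pow_even_gaussianReal_one`,
  `…integral_pow_odd_gaussianReal`);
* `integral_hermiteR_succ_mul` : `∫ He_{n+1} q dγ₁ = ∫ Heₙ q' dγ₁`, hence
  `∫ Heₙ q dγ₁ = ∫ q⁽ⁿ⁾ dγ₁` and **orthogonality**
  `∫ Heₘ Heₙ dγ₁ = n! δₘₙ` (`integral_hermiteR_mul_hermiteR`), `∫ Heₙ dγ₁ = δₙ₀`.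

These are the one-dimensional inputs of the Wiener–Hermite (chaos) expansion on a
finite-dimensional Gaussian space used in the spectral-gap proof for the linearised Boltzmann
operator (`Literature.Analysis.UnboundedOperators.LinearizedBoltzmann`).

## References
* S. Janson, *Gaussian Hilbert Spaces*, Cambridge Tracts in Math. 129 (1997), Example 2.9,
  Example 3.18 formula (3.12) (`∫ hₘ hₙ dγ₁ = n! δₘₙ`) and Theorem 3.21.
* C. Stein, *A bound for the error in the normal approximation…*, Proc. Sixth Berkeley Symp. 2
  (1972) 583–602 (the identity `E[X f(X)] = E[f'(X)]`).
-/

open MeasureTheory ProbabilityTheory Polynomial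
open scoped Nat

namespace Literature.Probability.Distributions

noncomputable section

/-! ### The Appell property `He_{n+1}' = (n+1) Heₙ` -/

/-- **Appell property of the Hermite polynomials**: `He_{n+1}' = (n + 1) Heₙ`
(the Hermite polynomials form an Appell sequence). [folklore] -/
theorem derivative_hermite_succ (n : ℕ) :
    derivative (hermite (n + 1)) = (n + 1) • hermite n := by
  induction n with
  | zero => simp
  | succ n ih =>
    rw [hermite_succ (n + 1), derivative_sub, derivative_mul, derivative_X, one_mul, ih,
      derivative_smul, mul_smul_comm, add_sub_assoc, ← smul_sub, ← hermite_succ, add_smul (n + 1) 1,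
      one_smul]
    abel

/-- The Hermite polynomial `Heₙ` as a real polynomial. [folklore] -/
def hermiteR (n : ℕ) : ℝ[X] := (hermite n).map (Int.castRingHom ℝ)

/-- `He₀ = 1`. [folklore] -/
@[simp]
theorem hermiteR_zero : hermiteR 0 = 1 := by simp [hermiteR]

/-- The recursion `He_{n+1} = X Heₙ - Heₙ'` over `ℝ`. [folklore] -/
theorem hermiteR_succ (n : ℕ) : hermiteR (n + 1) = X * hermiteR n - derivative (hermiteR n) := by
  simp [hermiteR, hermite_succ, Polynomial.map_sub, Polynomial.map_mul, derivative_map]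

/-- `He_{n+1}' = (n + 1) Heₙ` over `ℝ`. [folklore] -/
theorem derivative_hermiteR_succ (n : ℕ) :
    derivative (hermiteR (n + 1)) = C ((n : ℝ) + 1) * hermiteR n := by
  rw [hermiteR, derivative_map, derivative_hermite_succ, nsmul_eq_mul, Polynomial.map_mul,
    ← hermiteR]
  congr 1
  simp

/-- `Heₙ` has degree `n`. [folklore] -/
@[simp]
theorem natDegree_hermiteR (n : ℕ) : (hermiteR n).natDegree = n := by
  rw [hermiteR, natDegree_map_eq_of_injective Int.cast_injective, natDegree_hermite]

/-- `Heₙ` is monic. [folklore] -/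
theorem monic_hermiteR (n : ℕ) : (hermiteR n).Monic :=
  (hermite_monic n).map _

/-- The `n`-th derivative of `Heₙ` is the constant `n!`. [folklore] -/
theorem iterate_derivative_hermiteR_self (n : ℕ) :
    derivative^[n] (hermiteR n) = C (n ! : ℝ) := by
  have hdeg : (derivative^[n] (hermiteR n)).natDegree = 0 := by
    have h := natDegree_iterate_derivative (hermiteR n) n
    rw [natDegree_hermiteR, Nat.sub_self] at h
    exact Nat.le_zero.1 h
  rw [eq_C_of_natDegree_eq_zero hdeg]
  congr 1
  rw [coeff_iterate_derivative, zero_add, Nat.descFactorial_self]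
  have : (hermiteR n).coeff n = 1 := by
    simpa [natDegree_hermiteR] using (monic_hermiteR n).coeff_natDegree
  rw [this, nsmul_eq_mul, mul_one]

/-! ### Polynomials against the standard Gaussian -/

/-- Polynomials are integrable against a real Gaussian. [folklore] -/
theorem integrable_eval_gaussianReal (p : ℝ[X]) (μ : ℝ) (v : NNReal) :
    Integrable (fun x => p.eval x) (gaussianReal μ v) := by
  have h : (fun x => p.eval x) = fun x => ∑ i ∈ Finset.range (p.natDegree + 1),
      p.coeff i * x ^ i := by
    funext x
    exact eval_eq_sum_range x
  rw [h]
  exact integrable_finsetSum _ fun i _ => (integrable_pow_gaussianReal μ v i).const_mul _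

/-- `x p(x)` is integrable against a real Gaussian. [folklore] -/
theorem integrable_id_mul_eval_gaussianReal (p : ℝ[X]) (μ : ℝ) (v : NNReal) :
    Integrable (fun x => x * p.eval x) (gaussianReal μ v) := by
  have := integrable_eval_gaussianReal (X * p) μ v
  simpa using this

/-- The product of two polynomial functions is integrable against a real Gaussian. [folklore] -/
theorem integrable_eval_mul_eval_gaussianReal (p q : ℝ[X]) (μ : ℝ) (v : NNReal) :
    Integrable (fun x => p.eval x * q.eval x) (gaussianReal μ v) := by
  have := integrable_eval_gaussianReal (p * q) μ v
  simpa using this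

/-- **Moment recursion of the standard Gaussian**: `∫ x · xᵏ dγ₁ = k ∫ x^{k-1} dγ₁`. [folklore] -/
theorem integral_id_mul_pow_gaussianReal (k : ℕ) :
    ∫ x, x * x ^ k ∂gaussianReal 0 1 = k * ∫ x, x ^ (k - 1) ∂gaussianReal 0 1 := by
  have hpow : ∀ x : ℝ, x * x ^ k = x ^ (k + 1) := fun x => by ring
  simp_rw [hpow]
  rcases Nat.even_or_odd k with ⟨r, rfl⟩ | ⟨r, rfl⟩
  · -- `k = 2r`: both sides vanish
    rw [show r + r + 1 = 2 * r + 1 by ring, integral_pow_odd_gaussianReal]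
    cases r with
    | zero => simp
    | succ r' =>
      have e : r' + 1 + (r' + 1) - 1 = 2 * r' + 1 := by omega
      rw [e, integral_pow_odd_gaussianReal, mul_zero]
  · -- `k = 2r + 1`
    rw [show 2 * r + 1 + 1 = 2 * (r + 1) by ring, integral_pow_even_gaussianReal_one,
      show 2 * r + 1 - 1 = 2 * r by omega, integral_pow_even_gaussianReal_one,
      show 2 * (r + 1) - 1 = 2 * r + 1 by omega, Nat.doubleFactorial_add_one]
    push_cast
    ring

/-- **Stein's identity for polynomials**: `∫ x p(x) dγ₁(x) = ∫ p'(x) dγ₁(x)` for the standard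
Gaussian `γ₁`. [folklore] -/
theorem integral_id_mul_eval_gaussianReal (p : ℝ[X]) :
    ∫ x, x * p.eval x ∂gaussianReal 0 1 = ∫ x, (derivative p).eval x ∂gaussianReal 0 1 := by
  induction p using Polynomial.induction_on' with
  | add p q hp hq =>
    simp only [eval_add, mul_add, derivative_add]
    rw [integral_add (integrable_id_mul_eval_gaussianReal p 0 1)
      (integrable_id_mul_eval_gaussianReal q 0 1), integral_add
      (integrable_eval_gaussianReal _ 0 1) (integrable_eval_gaussianReal _ 0 1), hp, hq]
  | monomial k a =>
    simp only [eval_monomial, derivative_monomial]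
    have h1 : ∀ x : ℝ, x * (a * x ^ k) = a * (x * x ^ k) := fun x => by ring
    simp_rw [h1, integral_const_mul, integral_id_mul_pow_gaussianReal k]
    ring

/-! ### Orthogonality of the Hermite polynomials -/

/-- `∫ He_{n+1} q dγ₁ = ∫ Heₙ q' dγ₁` (creation operator = adjoint of differentiation):
from `He_{n+1} = X Heₙ - Heₙ'` and Stein's identity applied to `Heₙ q`. [folklore] -/
theorem integral_hermiteR_succ_mul (n : ℕ) (q : ℝ[X]) :
    ∫ x, (hermiteR (n + 1)).eval x * q.eval x ∂gaussianReal 0 1 =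
      ∫ x, (hermiteR n).eval x * (derivative q).eval x ∂gaussianReal 0 1 := by
  have hstein := integral_id_mul_eval_gaussianReal (hermiteR n * q)
  simp only [eval_mul, derivative_mul, eval_add] at hstein
  rw [integral_add (integrable_eval_mul_eval_gaussianReal _ _ 0 1)
    (integrable_eval_mul_eval_gaussianReal _ _ 0 1)] at hstein
  have hlhs : ∫ x, (hermiteR (n + 1)).eval x * q.eval x ∂gaussianReal 0 1 =
      ∫ x, x * ((hermiteR n).eval x * q.eval x) ∂gaussianReal 0 1 -
        ∫ x, (derivative (hermiteR n)).eval x * q.eval x ∂gaussianReal 0 1 := by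
    rw [← integral_sub ((integrable_id_mul_eval_gaussianReal (hermiteR n * q) 0 1).congr
      (ae_of_all _ fun x => by simp [eval_mul]))
      (integrable_eval_mul_eval_gaussianReal _ _ 0 1)]
    refine integral_congr_ae (ae_of_all _ fun x => ?_)
    simp only [hermiteR_succ, eval_sub, eval_mul, eval_X]
    ring
  rw [hlhs, hstein]
  ring

/-- `∫ Heₙ q dγ₁ = ∫ q⁽ⁿ⁾ dγ₁` for every real polynomial `q`. [folklore] -/
theorem integral_hermiteR_mul_eq_iterate (n : ℕ) (q : ℝ[X]) :
    ∫ x, (hermiteR n).eval x * q.eval x ∂gaussianReal 0 1 =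
      ∫ x, (derivative^[n] q).eval x ∂gaussianReal 0 1 := by
  induction n generalizing q with
  | zero => simp
  | succ n ih =>
    rw [integral_hermiteR_succ_mul, ih, Function.iterate_succ_apply]

/-- `∫ Heₙ q dγ₁ = 0` if `deg q < n` (`Heₙ ⟂ 𝒫_{n-1}`, Janson 1997 Example 3.18 with Thm 2.6). [cite: Janson1997, Example 3.18 (3.12)] -/
theorem integral_hermiteR_mul_eq_zero_of_natDegree_lt {n : ℕ} {q : ℝ[X]} (hq : q.natDegree < n) :
    ∫ x, (hermiteR n).eval x * q.eval x ∂gaussianReal 0 1 = 0 := by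
  rw [integral_hermiteR_mul_eq_iterate, iterate_derivative_eq_zero hq]
  simp

/-- **Orthogonality of the Hermite polynomials in `L²(γ₁)`**: `∫ Heₘ Heₙ dγ₁ = n! δₘₙ`
(Janson 1997, Example 3.18, formula (3.12)). [cite: Janson1997, Example 3.18 (3.12)] -/
theorem integral_hermiteR_mul_hermiteR (m n : ℕ) :
    ∫ x, (hermiteR m).eval x * (hermiteR n).eval x ∂gaussianReal 0 1 =
      if m = n then (n ! : ℝ) else 0 := by
  rcases lt_trichotomy m n with h | rfl | h
  · rw [if_neg h.ne]
    have := integral_hermiteR_mul_eq_zero_of_natDegree_lt (n := n) (q := hermiteR m)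
      (by rwa [natDegree_hermiteR])
    simpa [mul_comm] using this
  · rw [if_pos rfl, integral_hermiteR_mul_eq_iterate, iterate_derivative_hermiteR_self]
    simp
  · rw [if_neg h.ne']
    exact integral_hermiteR_mul_eq_zero_of_natDegree_lt (by rwa [natDegree_hermiteR])

/-- `∫ Heₙ dγ₁ = δₙ₀` (`He₀ = 1` and orthogonality). [cite: Janson1997, Example 3.18 (3.12)] -/
theorem integral_hermiteR (n : ℕ) :
    ∫ x, (hermiteR n).eval x ∂gaussianReal 0 1 = if n = 0 then 1 else 0 := by
  have h := integral_hermiteR_mul_hermiteR n 0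
  simp only [hermiteR_zero, eval_one, mul_one, Nat.factorial_zero, Nat.cast_one] at h
  exact h

/-- `‖Heₙ‖²_{L²(γ₁)} = n!`. [cite: Janson1997, Example 3.18 (3.12)] -/
theorem integral_hermiteR_sq (n : ℕ) :
    ∫ x, (hermiteR n).eval x ^ 2 ∂gaussianReal 0 1 = (n ! : ℝ) := by
  have h := integral_hermiteR_mul_hermiteR n n
  rw [if_pos rfl] at h
  simpa [sq] using h

/-- The Hermite functions are continuous (polynomials). [folklore] -/
theorem continuous_eval_hermiteR (n : ℕ) : Continuous fun x : ℝ => (hermiteR n).eval x :=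
  (hermiteR n).continuous

/-- The derivative of `x ↦ He_{n+1}(x)` is `(n + 1) Heₙ(x)`. [folklore] -/
theorem hasDerivAt_eval_hermiteR_succ (n : ℕ) (x : ℝ) :
    HasDerivAt (fun y => (hermiteR (n + 1)).eval y) (((n : ℝ) + 1) * (hermiteR n).eval x) x := by
  have h := (hermiteR (n + 1)).hasDerivAt x
  rwa [derivative_hermiteR_succ, eval_mul, eval_C] at h

end

end Literature.Probability.Distributions
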